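import Literature.MathematicalPhysics.QuantumFieldTheory.Balaban1983to89.Beta.BlockLegs

/-!
# `Balaban1983to89.Beta.AxialBlockWeights` — the STRAIGHT-CONTOUR BLOCK-AVERAGING WEIGHTS on `ℤ⁴` are `BlockLegs.BlockData`
(`ρ = 2`, `Ω = 1`, `Ω∞ = 1`) for EVERY blocking scale; the block-and-contour averaged massless covariance has all four
(W1)-type legs unconditionally (β sub-cell, row BETA-an3 gen 5, node BETA-an3-g5-AXIAL; BETA-SPEC v1.9g §6.12 OWNERS (vi),
RULING (R7) «C_k, not Γ_k»; companion of `Beta.TwoPowerLegs` / `Beta.BlockLegs`, successor item (α) of the an3 lineage HANDOFF GEN 5)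

HONEST FRAMING (cell rule, verbatim): discharging `BetaPertH` makes Bałaban's UV stability UNCONDITIONAL — a real
constructive-QFT result; it is NOT the continuum limit and NOT the Clay problem.  (Gloss, BETA-SPEC v1.8d/v1.9b
l. 17–18, GAPS G-ref2-14 (a) / G-ref2-20 (a), verbatim: «UNCONDITIONAL» in [Balaban1989LargeFieldII] (B16) p. 355's
interval-hypothesis sense ONLY (`FlowStepRuns.p355Unconditional_of_partialSums` keeps `hnodes`); the located leaves
G-adv3-2 (left inequality of (0.1)/(2.50), d = 4), G-adv3-1 (U2 transfer of B14 Cor. 3's lower bound) and `SecondExpLeaf`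
REMAIN.  Gloss 2, BETA-SPEC v1.9e, beta-ref C-beta-78, BINDING: «unconditional» = `Beta.Assembly.EventualForm`-unconditional END
statement, NOT «Theorem 2 as printed».)  THIS MODULE DISCHARGES NOTHING of the series and asserts nothing about Bałaban's
averaging operators, propagators, kernels or β-functions: it defines an explicit, elementary weight system on `ℤ⁴` and
proves it satisfies the hypotheses of `BlockLegs.BlockData`.  Every declaration is `[folklore]`.  Value = kernel certificate
(audit cell `pub-balaban`, β sub-cell, unit `b2b-balaban-beta-an3-g5`), NOT summit progress.

WHAT THIS MODULE IS.  `BlockLegs.block` / `BlockLegs.stepBal_le_of_freeBlockSharp` hold for ARBITRARY block data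
(scale `n(L,k) ≥ 1`, offsets `‖m‖∞ ≤ ρn`, weights `Σω = 1`, `Σ|ω| ≤ Ω`, `|ω| ≤ Ω∞/n⁴`).  Here ONE concrete datum is
supplied, the natural one for bond variables: average over the `n⁴` points `x` of the fine block of side `n` with base
corner `0` (`fineBlock n = {0 ≤ xᵢ < n}`) AND over the `n` bonds `x + j·e_μ`, `0 ≤ j < n`, of the straight contour from `x`
in direction `μ` — index set `idx n = fineBlock n × range n` (`#idx n = n⁵`, `card_idx`), point map
`pt μ (x, j) = x + j·e_μ`, weight of a point `m` = (multiplicity of `m` under `pt μ`)/`n⁵` (`axialWeight`; a tent profile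
in direction `μ`, flat in the others):
* `sum_axialWeight`: `Σ_m ω(m) = #idx/n⁵ = 1` (`Finset.card_eq_sum_card_image`);
* `card_fiber_le` / `axialWeight_le`: each fibre has `≤ n` elements (the contour position determines the block point),
  so `0 ≤ ω(m) ≤ n/n⁵ = 1/n⁴` — FLATNESS with `Ω∞ = 1`; `Σ|ω| = Σω = 1 = Ω`;
* `supNorm_le_of_mem`: support in `‖m‖∞ ≤ 2n − 1 ≤ 2n` — `ρ = 2`;
* `axialBlockData n hn μ : BlockData` for EVERY scale function `n : ℕ → ℕ → ℕ` with `1 ≤ n L k` (e.g. `scaleLk L k =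
  (max L 1)^k`, `axialBlockDataLk`) and every direction `μ`;
* `blockAvg_axial`: over these weights `BlockLegs.blockAvg T D L k y` IS the literal double average
  `n⁻¹⁰ Σ_{(x,j),(x′,j′) ∈ idx n} n²·g(n·y + (x + j e_μ) − (x′ + j′ e_μ))` (`Finset.sum_comp`) — the covariance, at unit-lattice
  separation `y`, of the block-and-contour average of a fine field of covariance `g`, rescaled by the canonical field
  dimension (`n² = n^{d−2}`, `d = 4`);
* §4, KERNEL COROLLARY `stepBal_le_of_axialFreeBlockSharp` (= `BlockLegs.stepBal_le_of_freeBlockSharp` at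
  `D = axialBlockData n hn λ`): the block-and-contour averaged MASSLESS covariance `g = latticeGreen/2`, for EVERY blocking scale
  `n(L,k)` and every contour direction `λ`, has all four (W1)-type legs (`baseLeg`, `fwdLeg μ`, mixed, `fwdLeg ν` of
  TwoPowerLegs) with `(L,k)`-FREE constants, UNCONDITIONALLY; the wall then follows from (W2)/(W3)/window comparability alone.

CONTEXT ONLY (NOT ASSERTED, NOT USED).  [Balaban1984PropagatorsI] (INDEX B5) p. 28, verbatim: «(Q_kA)~_μ(p′) =
Σ_l u(p′+l)v_μ(p′+l)Ã_μ(p′+l), v_μ(p) = ∂¹_μ(p′)/∂_μ(p), (1.61)»; «(φω)~_μ(p′) = φ_μ(p′)ω̃_μ(p′), φ_μ(p′) =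
Σ_l |u(p′+l)|²|v_μ(p′+l)|²/Δ(p′+l), (1.62) where we have omitted the subscript k.»  READING (the dictionary's business —
BETA-SPEC §6.12 OWNERS (iii)/(v) — and NOT claimed here): `v_μ = ∂¹_μ/∂_μ` is the Fourier multiplier of the average over
`n` consecutive bonds in direction `μ`, and IF `u` is the multiplier of the uniform average over the fine block then
`φ_μ` of (1.62) is the symbol of exactly the double average `blockAvg free (axialBlockData …)` of this module (with the fine
covariance `1/Δ`); whether and with which local / gauge-fixing / Woodbury corrections Bałaban's (R7) `C_k` has these window
legs is GAPS G-beta-an3-6 (G6-a) as UPDATED (gen 5), owned by rows an2 (iii) / Ward (iv) / 𝒦_k (v).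

WHAT THIS MODULE DOES NOT DO.  No claim about Bałaban's `Q_k`, `u`, `H_k`, `Δ_k`, `C_k` or β-functions; no (W2)/(W3) input
(`hin`, `hout` stay hypotheses); no tree contours `Γ_{y,x}` (B5 (1.6)–(1.8)) — only straight contours in one direction,
which is all the corollary needs as an EXAMPLE of admissible block data; other weight systems are other `BlockData`.

CITATION HEADER (cell ABSOLUTE RULE: the manuscripts under audit are context, never authority).
* [Balaban1984PropagatorsI] T. Bałaban, Propagators and renormalization transformations for lattice gauge theories. I,
  Comm. Math. Phys. 95 (1984) 17–40 (INDEX B5) — (1.61)–(1.62) p. 28.  CONTEXT ONLY.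
* Internal division of labour (NOT citations): BETA-SPEC.md v1.9g §6.12 / §7.12 (R7); AN3.md v5 §10–§11; GAPS G-beta-an3-6
  UPDATE (gen 5); an3 lineage HANDOFF GEN 5 item (α).

Tags: [folklore] = elementary combinatorics / real analysis proved here, or a structure/definition asserting nothing.
No `axiom`, no `sorry`; every theorem's hypotheses are explicit binders.
-/

noncomputable section

namespace Literature.MathematicalPhysics.QuantumFieldTheory.Balaban1983to89.Beta.AxialBlockWeights

open Finset
open Literature.Probability.LatticeModels (annulus box latticeGreen)
open Literature.MathematicalPhysics.QuantumFieldTheory.Balaban1983to89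
open Literature.MathematicalPhysics.QuantumFieldTheory.Balaban1983to89.Beta
open Literature.MathematicalPhysics.QuantumFieldTheory.Balaban1983to89.Beta.TransverseStructure
open Literature.MathematicalPhysics.QuantumFieldTheory.Balaban1983to89.Beta.TransverseLink
open Literature.MathematicalPhysics.QuantumFieldTheory.Balaban1983to89.Beta.LeadingCoefficient
open Literature.MathematicalPhysics.QuantumFieldTheory.Balaban1983to89.Beta.DyadicShell
open Literature.MathematicalPhysics.QuantumFieldTheory.Balaban1983to89.Beta.LargeLWindow (WindowDecomposition)
open Literature.MathematicalPhysics.QuantumFieldTheory.Balaban1983to89.Beta.BubbleTransfer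
open Literature.MathematicalPhysics.QuantumFieldTheory.Balaban1983to89.Beta.WindowInterface
open Literature.MathematicalPhysics.QuantumFieldTheory.Balaban1983to89.Beta.TwoPowerLegs
open Literature.MathematicalPhysics.QuantumFieldTheory.Balaban1983to89.Beta.BlockLegs

/-! ## §1. The fine block, the index set and the point map -/

/-- The fine block of side `n` with base corner `0`: `{x : ℤ⁴ | 0 ≤ xᵢ < n}`. [folklore] -/
def fineBlock (n : ℕ) : Finset Pt := Fintype.piFinset fun _ : Fin 4 => Finset.Ico (0 : ℤ) n

/-- membership in the fine block. [folklore] -/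
theorem mem_fineBlock {n : ℕ} {x : Pt} : x ∈ fineBlock n ↔ ∀ i, 0 ≤ x i ∧ x i < n := by
  simp [fineBlock, Fintype.mem_piFinset]

/-- `#fineBlock n = n⁴`. [folklore] -/
theorem card_fineBlock (n : ℕ) : (fineBlock n).card = n ^ 4 := by
  simp [fineBlock, Fintype.card_piFinset]

/-- The index set of the block-and-contour average: a block point and a contour position. [folklore] -/
def idx (n : ℕ) : Finset (Pt × ℕ) := fineBlock n ×ˢ Finset.range n

/-- `#idx n = n⁵`. [folklore] -/
theorem card_idx (n : ℕ) : (idx n).card = n ^ 5 := by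
  simp [idx, card_product, card_fineBlock, pow_succ]

/-- The (base) point `x + j·e_μ` of the `j`-th bond of the straight contour from `x` in direction `μ`. [folklore] -/
def pt (μ : Fin 4) (q : Pt × ℕ) : Pt := q.1 + (q.2 : ℤ) • unitVec μ

/-- coordinates of `pt μ (x, j)`. [folklore] -/
theorem pt_apply (μ : Fin 4) (q : Pt × ℕ) (i : Fin 4) :
    pt μ q i = q.1 i + if i = μ then (q.2 : ℤ) else 0 := by
  simp [pt, unitVec, Pi.single_apply]

/-! ## §2. The axial block weights: normalisation, flatness, support -/

/-- support of the axial block weights: the image of the index set. [folklore] -/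
def axialSupport (n : ℕ) (μ : Fin 4) : Finset Pt := (idx n).image (pt μ)

/-- the fibre of the point map over `m`. [folklore] -/
def fiber (n : ℕ) (μ : Fin 4) (m : Pt) : Finset (Pt × ℕ) := (idx n).filter fun q => pt μ q = m

/-- the axial block weight of `m`: multiplicity over `n⁵`. [folklore] -/
def axialWeight (n : ℕ) (μ : Fin 4) (m : Pt) : ℝ := ((fiber n μ m).card : ℝ) / (n : ℝ) ^ 5

/-- `0 ≤ ω(m)`. [folklore] -/
theorem axialWeight_nonneg (n : ℕ) (μ : Fin 4) (m : Pt) : 0 ≤ axialWeight n μ m := by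
  unfold axialWeight; positivity

/-- NORMALISATION `Σ_m ω(m) = 1` (`n ≥ 1`). [folklore] -/
theorem sum_axialWeight {n : ℕ} (hn : 1 ≤ n) (μ : Fin 4) :
    ∑ m ∈ axialSupport n μ, axialWeight n μ m = 1 := by
  unfold axialWeight axialSupport fiber
  rw [← Finset.sum_div]
  have h := Finset.card_eq_sum_card_image (pt μ) (idx n)
  have hn' : (n : ℝ) ≠ 0 := by exact_mod_cast (by omega : n ≠ 0)
  rw [← Nat.cast_sum, ← h, card_idx]
  push_cast
  exact div_self (pow_ne_zero _ hn')

/-- each fibre has at most `n` elements: the contour position determines the block point. [folklore] -/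
theorem card_fiber_le (n : ℕ) (μ : Fin 4) (m : Pt) : (fiber n μ m).card ≤ n := by
  calc (fiber n μ m).card ≤ (Finset.range n).card := by
        refine Finset.card_le_card_of_injOn (fun q => q.2) ?_ ?_
        · intro q hq
          have hq' : q ∈ fiber n μ m := by simpa using hq
          simp only [fiber, idx, mem_filter, mem_product, mem_range] at hq'
          simpa using hq'.1.2
        · intro q hq q' hq' hj
          have h1 : q ∈ fiber n μ m := by simpa using hq
          have h2 : q' ∈ fiber n μ m := by simpa using hq'
          simp only [fiber, mem_filter] at h1 h2
          have hj' : q.2 = q'.2 := by simpa using hj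
          have e1 : q.1 = m - (q.2 : ℤ) • unitVec μ := by rw [← h1.2]; simp [pt]
          have e2 : q'.1 = m - (q'.2 : ℤ) • unitVec μ := by rw [← h2.2]; simp [pt]
          refine Prod.ext ?_ hj'
          rw [e1, e2, hj']
    _ = n := card_range n

/-- FLATNESS `ω(m) ≤ 1/n⁴` (`n ≥ 1`). [folklore] -/
theorem axialWeight_le {n : ℕ} (hn : 1 ≤ n) (μ : Fin 4) (m : Pt) :
    axialWeight n μ m ≤ 1 / (n : ℝ) ^ 4 := by
  unfold axialWeight
  have hn' : (0 : ℝ) < n := by exact_mod_cast hn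
  rw [div_le_div_iff₀ (by positivity) (by positivity), one_mul]
  calc ((fiber n μ m).card : ℝ) * (n : ℝ) ^ 4 ≤ n * (n : ℝ) ^ 4 := by
        gcongr; exact_mod_cast card_fiber_le n μ m
    _ = (n : ℝ) ^ 5 := by ring

/-- SUPPORT `‖m‖∞ ≤ 2n` on the support. [folklore] -/
theorem supNorm_le_of_mem {n : ℕ} {μ : Fin 4} {m : Pt} (hm : m ∈ axialSupport n μ) :
    supNorm m ≤ 2 * n := by
  simp only [axialSupport, mem_image] at hm
  obtain ⟨q, hq, rfl⟩ := hm
  simp only [idx, mem_product, mem_fineBlock, mem_range] at hq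
  rw [supNorm_le_iff]
  intro i
  have h1 := hq.1 i
  have h2 := hq.2
  have key : ((pt μ q i).natAbs : ℤ) ≤ 2 * n := by
    rw [pt_apply]
    split_ifs
    · rw [Int.natAbs_of_nonneg (by omega)]; omega
    · rw [add_zero, Int.natAbs_of_nonneg h1.1]; omega
  exact_mod_cast key

/-! ## §3. The block data and the literal double-average form -/

/-- The axial block data (`ρ = 2`, `Ω = 1`, `Ω∞ = 1`) for a scale function `n(L,k) ≥ 1` and a contour direction `μ`. [folklore] -/
def axialBlockData (n : ℕ → ℕ → ℕ) (hn : ∀ L k, 1 ≤ n L k) (μ : Fin 4) : BlockData where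
  n := n
  S L k := axialSupport (n L k) μ
  ω L k := axialWeight (n L k) μ
  ρ := 2
  Ω := 1
  Ωinf := 1
  nonneg_Ωinf := zero_le_one
  one_le_n := hn
  supp L k m hm := supNorm_le_of_mem hm
  sum_one L k := sum_axialWeight (hn L k) μ
  abs_sum_le L k := by
    rw [Finset.sum_congr rfl fun m _ => abs_of_nonneg (axialWeight_nonneg _ _ m)]
    exact (sum_axialWeight (hn L k) μ).le
  flat L k m _ := by
    rw [abs_of_nonneg (axialWeight_nonneg _ _ m)]
    exact axialWeight_le (hn L k) μ m


/-- the offset radius of the axial data is `2`. [folklore] -/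
@[simp] theorem axialBlockData_ρ (n : ℕ → ℕ → ℕ) (hn : ∀ L k, 1 ≤ n L k) (μ : Fin 4) :
    (axialBlockData n hn μ).ρ = 2 := rfl

/-- `Σ|ω|`-bound of the axial data is `1`. [folklore] -/
@[simp] theorem axialBlockData_Ω (n : ℕ → ℕ → ℕ) (hn : ∀ L k, 1 ≤ n L k) (μ : Fin 4) :
    (axialBlockData n hn μ).Ω = 1 := rfl

/-- flatness constant of the axial data is `1`. [folklore] -/
@[simp] theorem axialBlockData_Ωinf (n : ℕ → ℕ → ℕ) (hn : ∀ L k, 1 ≤ n L k) (μ : Fin 4) :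
    (axialBlockData n hn μ).Ωinf = 1 := rfl

/-- the scale of the axial data is `n`. [folklore] -/
@[simp] theorem axialBlockData_n (n : ℕ → ℕ → ℕ) (hn : ∀ L k, 1 ≤ n L k) (μ : Fin 4) :
    (axialBlockData n hn μ).n = n := rfl

/-- The canonical blocking scale `L^k` (with `L = 0` read as `1`, so that it is `≥ 1` for all `(L,k)`; for `L ≥ 1` it is
`L^k`). [folklore] -/
def scaleLk (L k : ℕ) : ℕ := (max L 1) ^ k

/-- `scaleLk L k ≥ 1`. [folklore] -/
theorem one_le_scaleLk (L k : ℕ) : 1 ≤ scaleLk L k :=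
  Nat.one_le_pow _ _ (lt_of_lt_of_le one_pos (le_max_right _ _))

/-- `scaleLk L k = L^k` for `L ≥ 1`. [folklore] -/
theorem scaleLk_eq {L : ℕ} (hL : 1 ≤ L) (k : ℕ) : scaleLk L k = L ^ k := by
  simp [scaleLk, max_eq_left hL]

/-- The axial block data at the canonical scale `L^k`. [folklore] -/
def axialBlockDataLk (μ : Fin 4) : BlockData := axialBlockData scaleLk one_le_scaleLk μ

/-- a sum over an image with multiplicity weights is the sum over the index set. [folklore] -/
theorem sum_image_card_mul {ι κ : Type*} [DecidableEq κ] (s : Finset ι) (f : ι → κ) (F : κ → ℝ) :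
    ∑ m ∈ s.image f, ((s.filter fun q => f q = m).card : ℝ) * F m = ∑ q ∈ s, F (f q) := by
  rw [Finset.sum_comp F f]
  refine Finset.sum_congr rfl fun m _ => ?_
  rw [nsmul_eq_mul]

/-- averaging against the axial weights = averaging over the index set. [folklore] -/
theorem sum_axialWeight_mul (n : ℕ) (μ : Fin 4) (G : Pt → ℝ) :
    ∑ m ∈ axialSupport n μ, axialWeight n μ m * G m = ∑ q ∈ idx n, G (pt μ q) / (n : ℝ) ^ 5 := by
  unfold axialSupport axialWeight fiber
  rw [← sum_image_card_mul (idx n) (pt μ) (fun m => G m / (n : ℝ) ^ 5)]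
  refine Finset.sum_congr rfl fun m _ => ?_
  ring

/-- The block average over the axial weights is the literal double average over block points
and contour positions. [folklore] -/
theorem blockAvg_axial (T : TwoPower) (n : ℕ → ℕ → ℕ) (hn : ∀ L k, 1 ≤ n L k) (μ : Fin 4)
    (L k : ℕ) (y : Pt) :
    blockAvg T (axialBlockData n hn μ) L k y =
      ∑ q ∈ idx (n L k), ∑ q' ∈ idx (n L k),
        (n L k : ℝ) ^ 2 * T.g L k (n L k • y + pt μ q - pt μ q') / (n L k : ℝ) ^ 10 := by
  show ∑ m ∈ axialSupport (n L k) μ, ∑ m' ∈ axialSupport (n L k) μ,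
      axialWeight (n L k) μ m * axialWeight (n L k) μ m' * ((n L k : ℝ) ^ 2 * T.g L k (n L k • y + m - m')) = _
  calc ∑ m ∈ axialSupport (n L k) μ, ∑ m' ∈ axialSupport (n L k) μ,
        axialWeight (n L k) μ m * axialWeight (n L k) μ m' * ((n L k : ℝ) ^ 2 * T.g L k (n L k • y + m - m'))
        = ∑ m ∈ axialSupport (n L k) μ, axialWeight (n L k) μ m *
            (∑ m' ∈ axialSupport (n L k) μ,
              axialWeight (n L k) μ m' * ((n L k : ℝ) ^ 2 * T.g L k (n L k • y + m - m'))) := by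
          refine Finset.sum_congr rfl fun m _ => ?_
          rw [Finset.mul_sum]
          refine Finset.sum_congr rfl fun m' _ => ?_
          ring
    _ = ∑ q ∈ idx (n L k), (∑ m' ∈ axialSupport (n L k) μ,
            axialWeight (n L k) μ m' * ((n L k : ℝ) ^ 2 * T.g L k (n L k • y + pt μ q - m'))) / (n L k : ℝ) ^ 5 :=
          sum_axialWeight_mul (n L k) μ (fun m => ∑ m' ∈ axialSupport (n L k) μ,
            axialWeight (n L k) μ m' * ((n L k : ℝ) ^ 2 * T.g L k (n L k • y + m - m')))
    _ = ∑ q ∈ idx (n L k), (∑ q' ∈ idx (n L k),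
            (n L k : ℝ) ^ 2 * T.g L k (n L k • y + pt μ q - pt μ q') / (n L k : ℝ) ^ 5) / (n L k : ℝ) ^ 5 := by
          refine Finset.sum_congr rfl fun q _ => ?_
          rw [sum_axialWeight_mul (n L k) μ (fun m' => (n L k : ℝ) ^ 2 * T.g L k (n L k • y + pt μ q - m'))]
    _ = _ := by
          refine Finset.sum_congr rfl fun q _ => ?_
          rw [Finset.sum_div]
          refine Finset.sum_congr rfl fun q' _ => ?_
          rw [div_div, ← pow_add]

/-! ## §4. Kernel corollary: the block-and-contour averaged massless covariance has all four legs -/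

/-- KERNEL COROLLARY (= `BlockLegs.stepBal_le_of_freeBlockSharp` at the axial block data): for EVERY scale function
`n(L,k) ≥ 1` and every contour direction `λ`, the block-and-contour averaged massless covariance
`n⁻¹⁰ Σ n²·(latticeGreen/2)(n·y + (x + j e_λ) − (x′ + j′ e_λ))` supplies ALL FOUR (W1)-type legs with `(L,k)`-free constants;
given (W2) `hin`, (W3) `hout` and window comparability, the wall `stepBal − constA ≤ β0` follows.  Nothing about Bałaban's
`C_k` is asserted (GAPS G-beta-an3-6 (G6-a) UPDATE). [folklore] -/
theorem stepBal_le_of_axialFreeBlockSharp (n : ℕ → ℕ → ℕ) (hn : ∀ L k, 1 ≤ n L k) (la : Fin 4) {μ ν : Fin 4}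
    (hμν : μ ≠ ν) {N : ℝ} (hN : N ≠ 0)
    {β0 : ℕ → ℕ → ℝ} {K : ℕ → ℕ → Pt → ℝ} {A₁' D' cc : ℝ} {M : ℕ → ℕ} (hD : 0 ≤ D') (hc : 1 ≤ cc)
    (hM : ∀ L : ℕ, 2 ≤ L → 1 ≤ M L ∧ (L : ℝ) ≤ cc * M L) (hML : ∀ L : ℕ, 2 ≤ L → M L ≤ L)
    (hin : ∀ L : ℕ, 2 ≤ L → ∀ k : ℕ, ∀ w : Pt, w ≠ 0 →
      |K L k w - toReal w μ * toReal w ν *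
          lattBubble Finset.univ ![2 * N * N * 6, 2 * N * N * 10]
            ![(freeBlock (axialBlockData n hn la)).baseLeg, (freeBlock (axialBlockData n hn la)).fwdLeg μ]
            ![freeBlockMixedLeg (axialBlockData n hn la) hμν, (freeBlock (axialBlockData n hn la)).fwdLeg ν] L k w| ≤
        D' / ((supNorm w : ℝ) ^ 2 * (L : ℝ) ^ 2))
    (hout : ∀ L : ℕ, 2 ≤ L → ∀ k : ℕ, |β0 L k - ∑ w ∈ annulus 4 0 (M L), K L k w| ≤ A₁') :
    ∀ L : ℕ, 2 ≤ L → ∀ k : ℕ,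
      B12Normalization.stepBal N L - WindowDecomposition.constA (|kappaBal N| * 24 + |kappaBal N| * 110592)
        (bubbleConst Finset.univ ![2 * N * N * 6, 2 * N * N * 10]
          ![(freeBlock (axialBlockData n hn la)).baseLeg, (freeBlock (axialBlockData n hn la)).fwdLeg μ]
          ![freeBlockMixedLeg (axialBlockData n hn la) hμν, (freeBlock (axialBlockData n hn la)).fwdLeg ν])
        (A₁' + 80 * D') cc (kappaBal N * transverseValue) ≤ β0 L k :=
  stepBal_le_of_freeBlockSharp (axialBlockData n hn la) hμν hN hD hc hM hML hin hout

/-- The same at the canonical scale `L^k` (`axialBlockDataLk`). [folklore] -/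
theorem stepBal_le_of_axialFreeBlockSharpLk (la : Fin 4) {μ ν : Fin 4} (hμν : μ ≠ ν) {N : ℝ} (hN : N ≠ 0)
    {β0 : ℕ → ℕ → ℝ} {K : ℕ → ℕ → Pt → ℝ} {A₁' D' cc : ℝ} {M : ℕ → ℕ} (hD : 0 ≤ D') (hc : 1 ≤ cc)
    (hM : ∀ L : ℕ, 2 ≤ L → 1 ≤ M L ∧ (L : ℝ) ≤ cc * M L) (hML : ∀ L : ℕ, 2 ≤ L → M L ≤ L)
    (hin : ∀ L : ℕ, 2 ≤ L → ∀ k : ℕ, ∀ w : Pt, w ≠ 0 →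
      |K L k w - toReal w μ * toReal w ν *
          lattBubble Finset.univ ![2 * N * N * 6, 2 * N * N * 10]
            ![(freeBlock (axialBlockDataLk la)).baseLeg, (freeBlock (axialBlockDataLk la)).fwdLeg μ]
            ![freeBlockMixedLeg (axialBlockDataLk la) hμν, (freeBlock (axialBlockDataLk la)).fwdLeg ν] L k w| ≤
        D' / ((supNorm w : ℝ) ^ 2 * (L : ℝ) ^ 2))
    (hout : ∀ L : ℕ, 2 ≤ L → ∀ k : ℕ, |β0 L k - ∑ w ∈ annulus 4 0 (M L), K L k w| ≤ A₁') :
    ∀ L : ℕ, 2 ≤ L → ∀ k : ℕ,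
      B12Normalization.stepBal N L - WindowDecomposition.constA (|kappaBal N| * 24 + |kappaBal N| * 110592)
        (bubbleConst Finset.univ ![2 * N * N * 6, 2 * N * N * 10]
          ![(freeBlock (axialBlockDataLk la)).baseLeg, (freeBlock (axialBlockDataLk la)).fwdLeg μ]
          ![freeBlockMixedLeg (axialBlockDataLk la) hμν, (freeBlock (axialBlockDataLk la)).fwdLeg ν])
        (A₁' + 80 * D') cc (kappaBal N * transverseValue) ≤ β0 L k :=
  stepBal_le_of_freeBlockSharp (axialBlockDataLk la) hμν hN hD hc hM hML hin hout

end Literature.MathematicalPhysics.QuantumFieldTheory.Balaban1983to89.Beta.AxialBlockWeights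

end
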